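import Summits.CriticalPhenomena.CardyFormulaZ2.Theorems.HalfPlaneMarkDensityLaw.Negative.MarkEvents
import Literature.Probability.Percolation.KSTPeriodicSymmetry
import Literature.Probability.Percolation.PlanarDuality
import Literature.Probability.Percolation.Z2HalfPlaneTwoArm

/-!
# Line `Sketch`, self-duality programme, Stage II: the deterministic cover `fewR_cover`
# (crux stmt-CriticalPhenomena-5661, lead c3-0)

Bottom-row insensitivity, "few touches" event. In the lattice half-plane `H = ℤ × ℕ` of
bond-`ℤ²`, let `r` be the least point of `[1, S] × {0}` joined inside `H` to a far set `I`, and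
suppose its `H`-cluster has at most `M` touches `(b, 0)`, `b ∈ [0, S]`. Then (purely
deterministically) one of three things happens:
* (E1) the short arc `[0, ℓ] × {0}` is joined inside `H` to `I`;
* (E2) the short arc `[S - ℓ, S] × {0}` is joined inside `H` to `I`;
* (B) some `t` with `ℓ ≤ t ≤ S - ℓ` has `(t, 0)` joined inside `H` to `I`, every touch
  `u ∈ [0, S]` of its `H`-cluster lies in `[ℓ, S - ℓ]`, and there are at most `M` of them.
Indeed, if some touch `u` of the cluster of `(r, 0)` lies in an end zone, the corresponding short
arc is joined to `I` through `(u, 0) ↔ (r, 0) ↔ I`; otherwise `t := r` works, `r` being a touch of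
its own cluster.
-/

noncomputable section

namespace Summit.CriticalPhenomena.CardyFormulaZ2.Cruxes.HalfPlaneMarkDensityLaw.SketchLine.SelfDual

open Literature.Probability.Percolation Literature.Probability.LatticeModels
open Literature.Probability.Percolation.Z2HalfPlane (leg adj_leg)
open MeasureTheory Filter Set SimpleGraph
open Summit.CriticalPhenomena.CardyFormulaZ2.Theorems.HalfPlaneMarkDensityLaw.Negative

/-- **Deterministic cover of the "few touches" event.** If `r ∈ [1, S]` is the least boundary
point of `[1, S] × {0}` joined inside the half-plane `H` to `I` and the `H`-cluster of `(r, 0)`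
has at most `M` touches `(b, 0)`, `b ∈ [0, S]`, then either the short arc `[0, ℓ] × {0}` is
joined in `H` to `I`, or the short arc `[S - ℓ, S] × {0}` is, or some `t ∈ [ℓ, S - ℓ]` has
`(t, 0)` joined in `H` to `I` with all touches `u ∈ [0, S]` of its `H`-cluster in `[ℓ, S - ℓ]`
and at most `M` of them (take a touch `u` of the cluster of `(r, 0)` in an end zone if there is
one, else `t := r`). [folklore] -/
theorem fewR_cover : ∀ (I : Set (Site 2)) (S ℓ : ℤ) (M : ℕ), {ω : BondConfig (Site 2) | ∃ r : ℤ, 1 ≤ r ∧ r ≤ S ∧ ω ∈ openCrossing halfPlane I {bpt r} ∧ (∀ r' : ℤ, 1 ≤ r' → r' < r → ω ∉ openCrossing halfPlane I {bpt r'}) ∧ {b : ℤ | 0 ≤ b ∧ b ≤ S ∧ ω ∈ openConnIn halfPlane (bpt r) (bpt b)}.ncard ≤ M} ⊆ openCrossing halfPlane (rowIcc 0 (0 + ℓ)) I ∪ openCrossing halfPlane (rowIcc (S - ℓ) S) I ∪ {ω : BondConfig (Site 2) | ∃ t : ℤ, 0 + ℓ ≤ t ∧ t ≤ S - ℓ ∧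 ω ∈ openCrossing halfPlane {bpt t} I ∧ (∀ u : ℤ, 0 ≤ u → u ≤ S → ω ∈ openConnIn halfPlane (bpt t) (bpt u) → 0 + ℓ ≤ u ∧ u ≤ S - ℓ) ∧ {u : ℤ | 0 ≤ u ∧ u ≤ S ∧ ω ∈ openConnIn halfPlane (bpt t) (bpt u)}.ncard ≤ M} := by
  intro I S ℓ M ω hω
  obtain ⟨r, hr1, hrS, ⟨x, hxI, y, hy, hxy⟩, -, hcard⟩ := hω
  rcases hy with rfl
  -- `x ∈ I` is joined inside `H` to `(r, 0)`; record the symmetric statement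
  obtain ⟨hxH, hrH, hreach⟩ := hxy
  have hrx : ω ∈ openConnIn halfPlane (bpt r) x := ⟨hrH, hxH, hreach.symm⟩
  by_cases hcase : ∃ u : ℤ, 0 ≤ u ∧ u ≤ S ∧ ω ∈ openConnIn halfPlane (bpt r) (bpt u) ∧
      (u ≤ 0 + ℓ ∨ S - ℓ ≤ u)
  · -- a touch `u` of the cluster of `(r, 0)` lies in an end zone: (E1) or (E2)
    obtain ⟨u, hu0, huS, ⟨_, huH, hru⟩, hu⟩ := hcase
    have hux : ω ∈ openConnIn halfPlane (bpt u) x := ⟨huH, hxH, (hreach.trans hru).symm⟩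
    rcases hu with hu | hu
    · exact Or.inl (Or.inl ⟨bpt u, ⟨rfl, hu0, hu⟩, x, hxI, hux⟩)
    · exact Or.inl (Or.inr ⟨bpt u, ⟨rfl, hu, huS⟩, x, hxI, hux⟩)
  · -- all touches lie in the bulk: (B) with `t := r`
    push Not at hcase
    have hrr : ω ∈ openConnIn halfPlane (bpt r) (bpt r) := ⟨hrH, hrH, Reachable.refl _⟩
    have hrbulk := hcase r (by omega) hrS hrr
    refine Or.inr ⟨r, by omega, by omega, ⟨bpt r, rfl, x, hxI, hrx⟩, fun u hu0 huS hru => ?_, hcard⟩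
    have := hcase u hu0 huS hru
    omega

end Summit.CriticalPhenomena.CardyFormulaZ2.Cruxes.HalfPlaneMarkDensityLaw.SketchLine.SelfDual
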